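import Summits.QuantumFields.BalabanUV.T4Continuum.Spine.NE9.DirectPairingApexBudget
import Summits.QuantumFields.BalabanUV.T4Continuum.Spine.NE9.DirectPairingCrossover

/-!
# T⁴ programme, spine estimate NE9 — THE KING ROUTE CONSUMES NE7b AT ITS SINGLE-SLOT SHAPE: `SlotDom` with a slot budget that only TENDS TO ZERO
# feeds the E-side END; the liaison's `Summable S` is the one field King drops — census item C43 (slot form) of cell `pub-balaban-gaps`, seat ne9 (gen 12)

Cell `pub-balaban-gaps` (YM blitz G2, seat ne9, unit `pub-balaban-gaps-ne9-g12`; record `run/shared/lean/pub/pub-balaban-gaps/ne/NE9.md` §5 rows C42 ∕ C43).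
Summits-side bookkeeping over the tree's node-U5 vocabulary (`T4HistoryPeeling.SlotDom` ∕ `SlotDom.bad_le` ∕ `SlotDom.toPeierlsDom` — NE7b's single-slot hypothesis
shape and the peeling theorem; `T4HybridMatching.HybridSandwich`; `T4MatchingClosure.ReindexedBudget` ∕ `goodClause_of_reindexed`) and this seat's `DirectPairingApex`
(C38b), `DirectPairingApexBudget` (C38d), `DirectPairingCrossover` (C39).  Companion of `DirectPairingEnd` (C42 ∕ C43: the `summable` fields of `RelWeightBound` ∕
`ShellWeightBound` are idle for King's matching and incompatible with an adapted window).  NO definition; nothing of Bałaban's asserted.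

WHY.  `DirectPairingEnd.king_end_of_window` (C43) takes the bad class of each pair `(K, K + n)` as two RELATIVE-WEIGHT inequalities with a weight `V·r₀^{m K} < 1`,
`→ 0`.  In the cell's design NE7b delivers LESS processed data: the single-slot shape `T4HistoryPeeling.SlotDom l₀ T A Bad S` (switch-off structure, slot activities
`x ≥ 0` with `Σ x ≤ S K`, single-slot conditional ratio bounds — the cell's R3 reading of [Balaban1989LargeFieldII] §1, NOT PRINTED), from which the peeling theorem
gives `Σ_{Bad} A ≤ (1 − e^{−S K})·Σ_T A` (`SlotDom.bad_le`) with NO condition on `S`, and the consecutive liaison `T4HistoryPeeling.relWeightBound_of_slotDom` then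
asks `Summable S` to build `RelWeightBound` — the field King cannot meet with an adapted window (`S K = V·r₀^{m K}`, `DirectPairingEnd.summableBudget_window_not_tendsto`).
QUESTION: does `SlotDom` with `S → 0` ONLY feed the King END?  ANSWER (kernel): yes — `peierlsWeight_tendsto` (`1 − e^{−S K} < 1` always, `→ 0` iff-free from `S → 0`) and
`king_end_of_slotDom`: `SlotDom` for both runs of every pair + nonnegative weights + the dictionary + the cell's `ReindexedBudget` whose recent slots carry C39's crossover
majorant and C40's window sum VERBATIM + the non-E-side rate pieces `→ 0` ⇒ Cauchy generating functions with uniform convergence on the `l₀`-ball, through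
`DirectPairingApex.cauchy_of_hybridSandwichFamily` (the hybrid sandwich assembled per `(K, n, t)` from `goodClause_of_reindexed` and `SlotDom.bad_le`).  So on the
King route NE7b is consumed at `SlotDom` with budget `S K → 0` — for the cut `j⋆(K) = K − m K` of an ADAPTED window this is `V·r₀^{m K} → 0`
(`DirectPairingWindow.tendsto_badBudget_of_window`), with NO p-series bookkeeping (`T4GoodClassBudget.summable_weightMajorant_log`) and NO `V < 1`.

VERDICT FOR THE ROW (C43, slot form): the one field of the cell's node-U5 design that King's organisation drops is the liaison's `Summable S` (equivalently
`RelWeightBound.summable`); everything upstream of it (NE7b's `SlotDom`, NE7's good clause ∕ `ReindexedBudget`, node U4′'s crossover, node U5b's window) is consumed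
AS TYPED.  HONEST RESIDUE unchanged: the producers (owner T4-DAG), instance 0∕1.  CLASSIFICATION OF NE9 UNCHANGED: WORK-bound (W1).

HONEST FRAMING: bookkeeping for rung (B)+1 on ONE FIXED finite four-torus; elementary real analysis on hypothesis SHAPES (NE7, NE7b's `SlotDom`, NE-R1, H-U5b-1 —
the cell's located new estimates, none in print for Bałaban's d = 4 procedure); (2.43)∕(2.44) are Bałaban's printed Theorem 2 of [III], displayed as the SHAPE of a size
branch and NOT proved here; NE9 NOT PRINTED ∕ NOT PROVED; spine PROVED 0∕9 unchanged; NOT UV stability, NOT the continuum limit, NOT infinite volume, NOT a mass gap,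
NOT Clay.  HONEST DEPENDENCY: continuum YM on T⁴ ⇐ BetaPertH ∧ nine spine estimates (0∕9 proved); BetaPertH ⇐ (D1) ∧ (D4) ∧ CAP+tail.

References (TYPES only): [King1986] = C. King, Commun. Math. Phys. **102** (1986) 649–677, Thm 3.4 (3.9) p. 656, p. 657; [Balaban1989LargeFieldII] = T. Bałaban,
Commun. Math. Phys. **122** (1989) 355–392, §1 (1.79) p. 383, (1.104) p. 391; [Balaban1988Convergent] = T. Bałaban, Commun. Math. Phys. **119** (1988) 243–285,
Thm 2 (2.43)–(2.44) p. 263.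
-/

namespace Summit.QuantumFields.BalabanUV.T4Continuum.NE9.DirectPairingEndSlot

open scoped BigOperators
open Finset Filter Topology
open Literature.MathematicalPhysics.QuantumFieldTheory.Balaban1983to89
open T4CauchySum (genFun genFunLim)
open T4HybridMatching (HybridSandwich)
open T4HistoryPeeling (SlotDom)
open T4MatchingClosure (ReindexedBudget goodClause_of_reindexed)
open Summit.QuantumFields.BalabanUV.T4Continuum.NE9.DirectPairingApex (cauchy_of_hybridSandwichFamily)
open Summit.QuantumFields.BalabanUV.T4Continuum.NE9.DirectPairingApexBudget (tendsto_reindexedDelta)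

/-- `S → 0 ⇒ 1 − e^{−S K} → 0`, and `1 − e^{−S K} < 1` for every `K` — the bad-class weight the peeling theorem produces from a slot budget `S`
(`T4HistoryPeeling.SlotDom.bad_le`) is admissible for King with no summability and no smallness. [folklore] -/
theorem peierlsWeight_tendsto {S : ℕ → ℝ} (hS : Tendsto S atTop (𝓝 0)) :
    Tendsto (fun K => 1 - Real.exp (-S K)) atTop (𝓝 0) ∧ ∀ K, 1 - Real.exp (-S K) < 1 := by
  refine ⟨?_, fun K => by linarith [Real.exp_pos (-S K)]⟩
  have h : Tendsto (fun K => 1 - Real.exp (-S K)) atTop (𝓝 (1 - Real.exp (-0))) :=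
    ((Real.continuous_exp.tendsto _).comp hS.neg).const_sub 1
  simpa using h

section Slot

variable {ι : Type*} [DecidableEq ι] {l₀ vol : ℝ} {Z : ℕ → ℝ → ℝ}
  {E₁ a Λ b₀ β' R₁ Cw : ℝ} {κ₀ : ℕ} {g : ℕ → ℝ} {gs : ℕ → ℕ → ℝ} {b w u s' s₂ S : ℕ → ℝ} {m : ℕ → ℕ}

/-- **THE E-SIDE END FROM NE7b's SINGLE-SLOT SHAPE WITH A SLOT BUDGET THAT ONLY TENDS TO ZERO.**  INPUT: one profile `b ≥ 0`, `b → 0` (§17 rows 1–5 of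
`NE9.md`); printed size data (`E₁ ≥ 0`, `0 ≤ a < 1`, `R₁ ≥ 0`, `κ₀ > 2`, the lower half of (0.31) `Step.Discrete031`, nonnegative couplings); a window `m` whose deviation
window sum `Σ_{j=K−m K}^{K} b_jΛ^{K−j} → 0` (`DirectPairingWindow.exists_kingWindow`); NE7b's `SlotDom` for BOTH runs of every pair `(K, K + n)` with a common slot budget
`S K → 0` (for the cut `K − m K`: `V·r₀^{m K}`, NOT summable in general); nonnegative weights; the dictionary with positive totals; the cell's `ReindexedBudget` per `n` whose
recent slots carry VERBATIM `r K = Σ_{j+n=K} min(E₁aⁿ, b_jΛⁿ) + Σ_{j+n=K} min(R₁ g_j^{κ₀}, b_jΛⁿ) + w K` (node U4′, C39) and `s K = Cw·Σ_{j=K−m K}^{K} b_jΛ^{K−j} + s' K`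
(node U5b, C40); the non-E-side pieces `w, u, s', s₂ → 0`.  CONCLUSION: every `K ↦ genFun Z K t`, `|t| ≤ l₀`, is Cauchy with uniform convergence on the `l₀`-ball —
`SlotDom.bad_le` ∕ `toPeierlsDom` (weight `1 − e^{−S K}`), `goodClause_of_reindexed`, `DirectPairingCrossover.tendsto_kingCrossover`, `tendsto_reindexedDelta` and
`DirectPairingApex.cauchy_of_hybridSandwichFamily` BY NAME (the hybrid sandwich assembled per `(K, n, t)`; = `DirectPairingEnd.cauchy_of_reindexedBudget₀` with NE7b's
weight).  CONDITIONAL kernel theorem on hypothesis SHAPES; nothing of [I]–[III] ∕ [B16] asserted. [cite: King1986, Thm 3.4 (3.9) p. 656, p. 657] [folklore] -/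
theorem king_end_of_slotDom (hvol : 0 < vol) (hl₀ : 0 ≤ l₀)
    (hb0 : ∀ j, 0 ≤ b j) (hb : Tendsto b atTop (𝓝 0)) (hE₁ : 0 ≤ E₁) (ha0 : 0 ≤ a) (ha1 : a < 1) (hΛ : 0 ≤ Λ)
    (hb₀ : 0 < b₀) (h031 : ∀ K, Step.Discrete031 b₀ β' K (g K) (gs K)) (hgs : ∀ K k, k ≤ K → 0 ≤ gs K k)
    (hR₁ : 0 ≤ R₁) (hκ : 2 < κ₀) (hS : Tendsto S atTop (𝓝 0))
    (hwin : Tendsto (fun K => ∑ j ∈ Icc (K - m K) K, b j * Λ ^ (K - j)) atTop (𝓝 0))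
    (hw : Tendsto w atTop (𝓝 0)) (hu : Tendsto u atTop (𝓝 0)) (hs' : Tendsto s' atTop (𝓝 0))
    (hs₂ : Tendsto s₂ atTop (𝓝 0))
    (T : ℕ → ℕ → Finset ι) (A B : ℕ → ℕ → ℝ → ι → ℝ) (Bad : ℕ → ℕ → ℝ → Finset ι)
    (Cc Rr CcRec RrRec : ℕ → ℕ → ℝ → ι → ℝ) (ν c₀ : ℕ → ℕ → ℝ)
    (hZA : ∀ n K t, |t| ≤ l₀ → Z K t = ∑ τ ∈ T n K, A n K t τ)
    (hZB : ∀ n K t, |t| ≤ l₀ → Z (K + n) t = ∑ τ ∈ T n K, B n K t τ)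
    (hpos : ∀ n K t, |t| ≤ l₀ → 0 < ∑ τ ∈ T n K, A n K t τ)
    (hA : ∀ n K t, |t| ≤ l₀ → ∀ τ ∈ T n K, 0 ≤ A n K t τ) (hB : ∀ n K t, |t| ≤ l₀ → ∀ τ ∈ T n K, 0 ≤ B n K t τ)
    (hDA : ∀ n, SlotDom l₀ (T n) (A n) (Bad n) S) (hDB : ∀ n, SlotDom l₀ (T n) (B n) (Bad n) S)
    (hRB : ∀ n, ReindexedBudget l₀ vol (T n) (A n) (B n) (Bad n) (Cc n) (Rr n) (CcRec n) (RrRec n) (ν n) u s₂ (c₀ n)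
      (fun K => (∑ p ∈ antidiagonal K, min (E₁ * a ^ p.2) (b p.1 * Λ ^ p.2))
        + (∑ p ∈ antidiagonal K, min (R₁ * gs K p.1 ^ κ₀) (b p.1 * Λ ^ p.2)) + w K)
      (fun K => Cw * ∑ j ∈ Icc (K - m K) K, b j * Λ ^ (K - j) + s' K)) :
    (∀ t : ℝ, |t| ≤ l₀ → CauchySeq fun K => genFun Z K t) ∧
      TendstoUniformlyOn (fun K t => genFun Z K t) (genFunLim Z) atTop {t | |t| ≤ l₀} := by
  obtain ⟨hW0, hW1⟩ := peierlsWeight_tendsto hS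
  -- the four rate slots tend to zero: C39 (radius), hu (UV), C40 + the other kinds (deviation), hs₂
  have hr : Tendsto (fun K => (∑ p ∈ antidiagonal K, min (E₁ * a ^ p.2) (b p.1 * Λ ^ p.2))
      + (∑ p ∈ antidiagonal K, min (R₁ * gs K p.1 ^ κ₀) (b p.1 * Λ ^ p.2)) + w K) atTop (𝓝 0) :=
    DirectPairingCrossover.tendsto_kingCrossover hE₁ ha0 ha1 hΛ hb₀ h031 hgs hR₁ hκ hb0 hb hw
  have hs : Tendsto (fun K => Cw * ∑ j ∈ Icc (K - m K) K, b j * Λ ^ (K - j) + s' K) atTop (𝓝 0) := by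
    simpa using (hwin.const_mul Cw).add hs'
  refine cauchy_of_hybridSandwichFamily (W := fun K => 1 - Real.exp (-S K)) hvol hl₀ (fun K n => T n K) (fun K n => A n K)
    (fun K n => B n K) (fun K n t ht => hZA n K t ht) (fun K n t ht => hZB n K t ht) hW1 (tendsto_reindexedDelta hr hu hs hs₂)
    hW0 (fun K n t ht => hpos n K t ht) fun K n => ?_
  -- the hybrid sandwich per (K, n, t): good clause from the re-indexed budget, bad class from the peeling theorem
  obtain ⟨c, hc⟩ := goodClause_of_reindexed (hRB n) K
  refine ⟨c, fun t ht => ⟨T n K \ Bad n K t, ?_⟩⟩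
  have hBad : Bad n K t ⊆ T n K := ((hDA n).toPeierlsDom (hA n)).bad_subset K t ht
  have hsd : T n K \ (T n K \ Bad n K t) = Bad n K t := by
    rw [sdiff_sdiff_right_self, inf_eq_inter, inter_eq_right.mpr hBad]
  exact
    { subset := sdiff_subset
      nonneg_left := hA n K t ht
      nonneg_right := hB n K t ht
      lower := fun τ hτ => (hc t ht τ hτ).1
      upper := fun τ hτ => (hc t ht τ hτ).2
      bad_left := by rw [hsd]; exact (hDA n).bad_le (hA n) K t ht
      bad_right := by rw [hsd]; exact (hDB n).bad_le (hB n) K t ht }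

end Slot

end Summit.QuantumFields.BalabanUV.T4Continuum.NE9.DirectPairingEndSlot
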